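/-
Copyright: the b2b-balaban T⁴-continuum CRUX team, row NE7b leaf lineage `t4-ne7b-formalise-leaf-05` (gen 156). Project licence.
-/
import Summits.QuantumFields.BalabanUV.T4Continuum.Spine.NE7b.LinearisedStokesRectScript
import Summits.QuantumFields.BalabanUV.T4Continuum.Spine.NE7b.NonAbelianStokesSkylineScript

/-!
# THE LINEARISED LATTICE STOKES IDENTITY FOR SKYLINE REGIONS THROUGH THEIR SCRIPTS — junction of `LinearisedLatticeStokesDisc` (part III:
# scripts read in `N ⋊[φ] G`) with `NonAbelianStokesSkylineScript` (histogram regions `{(i, j) : i < n, j < K i}` as plaquette scripts): the stages,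
# flat exactness with the COMB transports, the curvature defect in the skyline plaquette-sum currency, and the stage budget from ONE bond letter and
# the region's perimeter (row NE7b, node U5c; the (h1) slot of print's `γ₀` assembly — `HOME/b2b-balaban-r1/SectE-interface-proof.md` Lemma CS (i)–(ii))

Cell `pub-balaban`, sub-cell `t4`, spine estimate NE7b (`T4WeightBudget.RelWeightBound`; the cell's OWN estimate — NOT PRINTED in [Bałaban 1983–89],
NOT PROVED).  Crux-route work under `Spine/NE7b/` by a row leaf; [folklore] list bookkeeping + tree theorems BY NAME; NOTHING of Bałaban's named,
asserted or valued; no `T4Continuum/Support` leaf typed; no `def`; zero `sorry`.  Imports this lineage's `LinearisedStokesRectScript` (for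
`stages_colMoves_append`, `stages_rowCancels_append`, `snd_mem_loops_of_mem_glued`; through it `LinearisedLatticeStokesDisc`) and
`NonAbelianStokesSkylineScript` (`skylineWord`, `skylineScript`, `build_skylineScript`, `sum_glued_skylineScript` BY NAME) ONLY.

WHY.  `LinearisedStokesRectScript` did this for the coordinate rectangle; Lemma CS (ii)'s comparison contours and the other discs of the cell (collars,
`L`-shapes, boundaries of block unions) are not rectangles.  `NonAbelianStokesSkylineScript` scripts every skyline region; `LinearisedLatticeStokesDisc`
reads any script in `N ⋊[φ] G`.  Composing the two BY NAME: the covariant boundary sum of a 1-form along `∂𝓡` EQUALS the sum of the comb-transported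
covariant curls of the `Σ_{i<n} K i` plaquettes when they are flat, and differs from it in general by a defect priced by the SAME skyline plaquette sum
`Σ_{i<n} Σ_{j<K i} dist1 U(∂p(x + ie_κ + je_μ))` that bounds `dist1 U(∂𝓡)` in `dist1_hol_skylineWord_le_sum`, times an explicit budget
`(|∂𝓡| + n + 3M) · a` (`M` a height cap, `a` a bond letter).

WHAT IS PROVED ([folklore]):
* §1 THE STAGES OF THE SKYLINE SCRIPT: `stages_skylineScript_zero`, **`stages_skylineScript_succ`** (column `n`'s `K n` stages: prefix `κ^n κ⁺ μ^j κ⁻` — the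
  comb to the corner `x + ne_κ + je_μ` and back down one bond —, loop `∂p_{κμ}`, entered word `κ^n κ⁺ μ^j κ⁻ μ̄^j ++ (∂𝓡_n minus its bottom edge)`,
  `j = K n − 1, …, 0`); perimeter bookkeeping `le_length_skylineWord`, `length_skylineWord_add_two_le` (each column adds ≥ 2 to the perimeter),
  `length_skylineWord_mono`; **`length_le_of_mem_stages_skylineScript`** (under a height cap `K i ≤ M`, `i < n`: `|α| ≤ n + M`, `|w| + 2 ≤ |∂𝓡| + 2M`).
* §2 **`left_hol_skylineWord_of_flat_script`** — flat plaquettes ⟹ `(∂𝓡).left = ∏_{stages} φ(U(κ^i κ⁺ μ^j κ⁻)) (∂p).left` EXACTLY.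
* §3 **`sz_skylineWord_script_defect_le`** — under the size letters and a stage budget `B`: `sz(∂𝓡.left ∕ comb flat formula) ≤ c·B·Σ_{i<n}Σ_{j<K i} dist1 U(∂p)`;
  **`sz_skylineWord_script_defect_le_of_bond_letter`** — with `sz 1 = 0`, `φ` `sz`-isometric, a bond letter `sz A(b) ≤ a` (`a ≥ 0`) and a height cap `M`
  the budget is `B = (|∂𝓡| + n + 3M)·a`.
* §4 toy: the three stages of the `L`-shape `K = (2, 1)`.

NOT HERE (honest): regions with a lower skyline ∕ holes; the comparison of the comb formula with row formulas; values of `ε_F`, `c_g`; which regions are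
Bałaban's ((A3) ∕ (A1c), NC-NE7b-α UNRULED).  BY-NAME EFFECT ON THE WALL: NONE.  NE7b NOT PRINTED ∕ NOT PROVED; spine PROVED 0∕9; rung (B)+1 on a FINITE
torus — NOT infinite volume, NOT the mass gap, NOT Clay.  HONEST DEPENDENCY: continuum YM on T⁴ ⇐ BetaPertH ∧ nine spine estimates (0/9 proved); BetaPertH
⇐ (D1) ∧ (D4) ∧ CAP+tail; G-an2-4 gates asym, D1 and NE2/3/4.
-/

set_option autoImplicit false

open scoped BigOperators

namespace Summit.QuantumFields.BalabanUV.T4Continuum.NE7b.LinearisedStokesSkylineScript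

open Literature.MathematicalPhysics.QuantumFieldTheory.Balaban1983to89 (GaugeGroup dist1)
open Literature.MathematicalPhysics.QuantumFieldTheory.Balaban1983to89.B7Prop1Explicit
  (Site Letter e disp hol plaqWord disp_plaqWord)
open NonAbelianStokesDisc
open LinearisedLatticeStokesDisc (stages stages_nil stages_backtrack left_hol_build_of_flat' sz_build_defect_le_plaquettes sz_left_hol_le_length_mul)
open NonAbelianStokesRectScript (colMoves rowCancels apply_backtrack_of_length)
open LinearisedStokesRectScript (stages_colMoves_append stages_rowCancels_append snd_mem_loops_of_mem_glued)
open NonAbelianStokesSkylineScript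

variable {d : ℕ}

/-! ## §1 The stages of the skyline script, and the perimeter bookkeeping -/

section Stages

/-- `stages` of the empty script. -/
theorem stages_skylineScript_zero (κ μ : Fin d) (K : ℕ → ℕ) :
    stages (skylineScript κ μ K 0) = ([] : List (List (Letter d) × List (Letter d) × List (Letter d))) := rfl

/-- **THE STAGES, ONE COLUMN AT A TIME**: column `n` (on top of the region of the first `n` columns) contributes its `K n` stages —
prefix `κ^n κ⁺ μ^j κ⁻` (the comb: along the bottom edge to `x + ne_κ`, up to the corner `x + ne_κ + je_μ` one bond to the right of it, and back), loop
`∂p_{κμ}`, entered word `κ^n κ⁺ μ^j κ⁻ μ̄^j` followed by the previous boundary word minus its bottom edge `(∂𝓡_n).drop n`, `j = K n − 1, …, 0`. [folklore] -/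
theorem stages_skylineScript_succ (κ μ : Fin d) (K : ℕ → ℕ) : ∀ n : ℕ,
    stages (skylineScript κ μ K (n + 1)) =
      ((List.range (K n)).reverse.map fun j : ℕ =>
        (List.replicate n ((κ, true) : Letter d) ++ ((κ, true) :: (List.replicate j ((μ, true) : Letter d) ++ [(κ, false)])), plaqWord κ μ,
          List.replicate n ((κ, true) : Letter d) ++ ((κ, true) :: (List.replicate j ((μ, true) : Letter d) ++ (κ, false) ::
            (List.replicate j ((μ, false) : Letter d) ++ (skylineWord κ μ K n).drop n)))))
        ++ stages (skylineScript κ μ K n)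
  | 0 => by
    have h1 : build [Move.backtrack 0 ((κ, true) : Letter d)] = ([] : List (Letter d)) ++ ((κ, true) :: (κ, false) :: ([] : List (Letter d))) := by
      rw [build, build]; exact apply_backtrack_of_length _ [] [] rfl
    rw [skylineScript_one, stages_colMoves_append κ μ (n := 0) [] [] rfl _ h1 (K 0), stages_backtrack, stages_nil]
    rfl
  | i + 1 => by
    have h1 : build (Move.backtrack (i + 1) (κ, true) :: skylineScript κ μ K (i + 1)) =
        List.replicate (i + 1) ((κ, true) : Letter d) ++ ((κ, true) :: (κ, false) ::
          (List.replicate (K i) ((μ, true) : Letter d) ++ skylineTail κ μ K i)) := by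
      rw [build, build_skylineScript, skylineWord_succ, apply_backtrack_of_length _ _ _ (List.length_replicate ..)]
      rfl
    have hdrop : (skylineWord κ μ K (i + 1)).drop (i + 1) = List.replicate (K i) ((μ, true) : Letter d) ++ skylineTail κ μ K i := by
      rw [skylineWord_succ]; exact List.drop_left' (List.length_replicate ..)
    rw [skylineScript_succ_succ, stages_rowCancels_append,
      stages_colMoves_append κ μ (List.replicate (i + 1) ((κ, true) : Letter d)) _ (List.length_replicate ..) _ h1 (K (i + 1)),
      stages_backtrack, hdrop]

/-- The boundary word is at least as long as its bottom edge `κ^n`. -/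
theorem le_length_skylineWord (κ μ : Fin d) (K : ℕ → ℕ) : ∀ n : ℕ, n ≤ (skylineWord κ μ K n).length
  | 0 => Nat.zero_le _
  | i + 1 => by rw [skylineWord_succ, List.length_append, List.length_replicate]; omega

/-- **EACH COLUMN ADDS AT LEAST TWO BONDS TO THE PERIMETER** (exactly `2 + 2(K n − min (K n) (K(n−1)))`). [folklore] -/
theorem length_skylineWord_add_two_le (κ μ : Fin d) (K : ℕ → ℕ) : ∀ n : ℕ,
    (skylineWord κ μ K n).length + 2 ≤ (skylineWord κ μ K (n + 1)).length
  | 0 => by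
    rw [skylineWord_zero, skylineWord_succ, skylineTail_zero]
    simp only [List.length_nil, List.length_append, List.length_replicate, List.length_cons]
    omega
  | i + 1 => by
    have hm1 : min (K (i + 1)) (K i) ≤ K (i + 1) := min_le_left _ _
    rw [skylineWord_succ, skylineWord_succ, skylineTail_succ]
    simp only [List.length_append, List.length_replicate, List.length_cons]
    omega

/-- Hence the perimeter is monotone in the number of columns, with slope ≥ 2. -/
theorem length_skylineWord_mono (κ μ : Fin d) (K : ℕ → ℕ) : ∀ {n i : ℕ}, i ≤ n →
    (skylineWord κ μ K i).length + 2 * (n - i) ≤ (skylineWord κ μ K n).length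
  | 0, i, hi => by rw [Nat.le_zero.mp hi]; simp
  | n + 1, i, hi => by
    rcases Nat.lt_or_eq_of_le hi with h | rfl
    · have ih := length_skylineWord_mono κ μ K (Nat.le_of_lt_succ h)
      have hs := length_skylineWord_add_two_le κ μ K n
      have : 2 * (n + 1 - i) = 2 * (n - i) + 2 := by omega
      omega
    · simp

/-- **STAGE LENGTHS UNDER A HEIGHT CAP**: if `K i ≤ M` for `i < n`, every stage `(α, σ, w)` of the `n`-column script has `|α| ≤ n + M` and
`|w| + 2 ≤ |∂𝓡_n| + 2M` (the entered word is an earlier boundary word, at least two bonds shorter, with the growing column `κ⁺ μ^j κ⁻ μ̄^j`, `j < M`,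
spliced in). [folklore] -/
theorem length_le_of_mem_stages_skylineScript (κ μ : Fin d) (K : ℕ → ℕ) (M : ℕ) : ∀ (n : ℕ), (∀ i, i < n → K i ≤ M) →
    ∀ t ∈ stages (skylineScript κ μ K n), t.1.length ≤ n + M ∧ t.2.2.length + 2 ≤ (skylineWord κ μ K n).length + 2 * M
  | 0, _, t, ht => by rw [stages_skylineScript_zero] at ht; simp at ht
  | n + 1, hK, t, ht => by
    have hstep := length_skylineWord_add_two_le κ μ K n
    rw [stages_skylineScript_succ, List.mem_append] at ht
    rcases ht with ht | ht
    · obtain ⟨j, hj, rfl⟩ := List.mem_map.mp ht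
      have hjK : j < K n := by simpa using hj
      have hKn : K n ≤ M := hK n (Nat.lt_succ_self n)
      have hlen := le_length_skylineWord κ μ K n
      constructor
      · simp; omega
      · simp only [List.length_append, List.length_replicate, List.length_cons, List.length_drop]
        omega
    · have ih := length_le_of_mem_stages_skylineScript κ μ K M n (fun i hi => hK i (Nat.lt_succ_of_lt hi)) t ht
      constructor <;> omega

end Stages

/-! ## §2 Flat exactness for skyline regions through their scripts -/

section Flat

variable {G N : Type*} [Group G] [CommGroup N] {φ : G →* MulAut N}
variable (W : Site d → Fin d → N ⋊[φ] G) (U : Site d → Fin d → G)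

/-- **FLAT EXACTNESS WITH THE COMB TRANSPORTS.**  If every plaquette glued by the skyline script is flat, `U(∂p(x + ie_κ + je_μ)) = 1`, then the `N`-part
of the region's boundary pair holonomy is EXACTLY `∏_{stages} φ(U(κ^i κ⁺ μ^j κ⁻)) (∂p).left` (`LinearisedLatticeStokesDisc.left_hol_build_of_flat'` ∘
`NonAbelianStokesSkylineScript.build_skylineScript`). [folklore] -/
theorem left_hol_skylineWord_of_flat_script (hU : ∀ y k, (W y k).right = U y k) (x : Site d) (κ μ : Fin d) (K : ℕ → ℕ) (n : ℕ)
    (hflat : ∀ q ∈ glued x (skylineScript κ μ K n), hol U q.1 q.2 = 1) :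
    (hol W x (skylineWord κ μ K n)).left =
      ((stages (skylineScript κ μ K n)).map fun t => φ (hol U x t.1) (hol W (x + disp t.1) t.2.1).left).prod := by
  rw [← build_skylineScript]
  exact left_hol_build_of_flat' W U hU x _ (fun σ hσ => by rw [eq_plaqWord_of_mem_loops_skylineScript κ μ K n hσ, disp_plaqWord]) hflat

end Flat

/-! ## §3 The curvature defect in the skyline plaquette-sum currency, and the explicit budget -/

section Defect

variable {G N : Type*} [GaugeGroup G] [CommGroup N] {φ : G →* MulAut N}
variable (W : Site d → Fin d → N ⋊[φ] G) (U : Site d → Fin d → G)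

/-- **THE DEFECT FOR A SKYLINE REGION THROUGH ITS SCRIPT**, in the plaquette-sum currency of `dist1_hol_skylineWord_le_sum`: under the size letters of
`LinearisedLatticeStokes` §3 and a stage budget `B`, `sz(∂𝓡.left ∕ comb flat formula) ≤ c · B · Σ_{i<n} Σ_{j<K i} dist1 U(∂p(x + ie_κ + je_μ))`. [folklore] -/
theorem sz_skylineWord_script_defect_le (hU : ∀ y k, (W y k).right = U y k) (sz : N → ℝ) {c B : ℝ} (hc : 0 ≤ c)
    (h0 : ∀ a, 0 ≤ sz a) (hmul : ∀ a b, sz (a * b) ≤ sz a + sz b) (hinv : ∀ a, sz a⁻¹ = sz a)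
    (hdef : ∀ (g : G) (a : N), sz (φ g a * a⁻¹) ≤ c * dist1 g * sz a) (x : Site d) (κ μ : Fin d) (K : ℕ → ℕ) (n : ℕ)
    (hB : ∀ t ∈ stages (skylineScript κ μ K n), sz (hol W x t.1).left + sz (hol W x t.2.2).left ≤ B) :
    sz ((hol W x (skylineWord κ μ K n)).left *
        (((stages (skylineScript κ μ K n)).map fun t => φ (hol U x t.1) (hol W (x + disp t.1) t.2.1).left).prod)⁻¹)
      ≤ c * B * ∑ i ∈ Finset.range n, ∑ j ∈ Finset.range (K i), dist1 (hol U (x + (i : ℤ) • e κ + (j : ℤ) • e μ) (plaqWord κ μ)) := by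
  rw [← build_skylineScript, ← sum_glued_skylineScript κ μ K x (fun q => dist1 (hol U q.1 (plaqWord κ μ))) n]
  exact sz_build_defect_le_plaquettes W U hU sz hc h0 hmul hinv hdef x _ (fun _ => (κ, μ))
    (fun q hq => Or.inl (eq_plaqWord_of_mem_loops_skylineScript κ μ K n (snd_mem_loops_of_mem_glued x _ q hq))) hB

/-- **THE DEFECT FROM ONE BOND LETTER AND THE PERIMETER.**  With `sz 1 = 0`, `φ` `sz`-isometric, `sz A(b) ≤ a` on every bond (`0 ≤ a`) and a height cap
`K i ≤ M` (`i < n`), the stage budget of the skyline script is `B = (|∂𝓡_n| + n + 3M)·a` (§1: `|α| ≤ n + M`, `|w| + 2 ≤ |∂𝓡_n| + 2M`;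
`LinearisedLatticeStokesDisc.sz_left_hol_le_length_mul`): `sz(∂𝓡.left ∕ comb flat formula) ≤ c·(|∂𝓡_n| + n + 3M)·a·Σ_{i<n}Σ_{j<K i} dist1 U(∂p)`. [folklore] -/
theorem sz_skylineWord_script_defect_le_of_bond_letter (hU : ∀ y k, (W y k).right = U y k) (sz : N → ℝ) {c a : ℝ} (hc : 0 ≤ c) (ha : 0 ≤ a)
    (h0 : ∀ b, 0 ≤ sz b) (h1 : sz 1 = 0) (hmul : ∀ b b', sz (b * b') ≤ sz b + sz b') (hinv : ∀ b, sz b⁻¹ = sz b)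
    (hiso : ∀ (g : G) (b : N), sz (φ g b) = sz b) (hdef : ∀ (g : G) (b : N), sz (φ g b * b⁻¹) ≤ c * dist1 g * sz b)
    (hbond : ∀ y k, sz (W y k).left ≤ a) (x : Site d) (κ μ : Fin d) (K : ℕ → ℕ) {M : ℕ} (n : ℕ) (hK : ∀ i, i < n → K i ≤ M) :
    sz ((hol W x (skylineWord κ μ K n)).left *
        (((stages (skylineScript κ μ K n)).map fun t => φ (hol U x t.1) (hol W (x + disp t.1) t.2.1).left).prod)⁻¹)
      ≤ c * (((skylineWord κ μ K n).length + n + 3 * M : ℕ) * a) *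
          ∑ i ∈ Finset.range n, ∑ j ∈ Finset.range (K i), dist1 (hol U (x + (i : ℤ) • e κ + (j : ℤ) • e μ) (plaqWord κ μ)) := by
  refine sz_skylineWord_script_defect_le W U hU sz hc h0 hmul hinv hdef x κ μ K n fun t ht => ?_
  obtain ⟨h1', h2'⟩ := length_le_of_mem_stages_skylineScript κ μ K M n hK t ht
  have e1 := sz_left_hol_le_length_mul W sz h1 hmul hinv hiso hbond x t.1
  have e2 := sz_left_hol_le_length_mul W sz h1 hmul hinv hiso hbond x t.2.2
  have h3 : (t.1.length : ℝ) * a ≤ (n + M : ℕ) * a := mul_le_mul_of_nonneg_right (by exact_mod_cast h1') ha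
  have h4 : (t.2.2.length : ℝ) * a ≤ ((skylineWord κ μ K n).length + 2 * M : ℕ) * a :=
    mul_le_mul_of_nonneg_right (by exact_mod_cast (by omega : t.2.2.length ≤ (skylineWord κ μ K n).length + 2 * M)) ha
  calc sz (hol W x t.1).left + sz (hol W x t.2.2).left ≤ (n + M : ℕ) * a + ((skylineWord κ μ K n).length + 2 * M : ℕ) * a := by linarith
    _ = ((skylineWord κ μ K n).length + n + 3 * M : ℕ) * a := by push_cast; ring

end Defect

/-! ## §4 Toy -/

/-- The `L`-shape `K = (2, 1)` (two columns): THREE stages, newest first — column `1`'s one plaquette (prefix `κ κ⁺ κ⁻`, entered word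
`κ κ⁺ κ⁻ · μ μ κ̄ μ̄ μ̄` = the backtracked `1 × 2` rectangle word), then column `0`'s two (prefixes `κ⁺ μ κ⁻`, `κ⁺ κ⁻`). -/
example (κ μ : Fin d) :
    stages (skylineScript κ μ (fun i => if i = 0 then 2 else 1) 2) =
      [([((κ, true) : Letter d), (κ, true), (κ, false)], plaqWord κ μ,
          [((κ, true) : Letter d), (κ, true), (κ, false), (μ, true), (μ, true), (κ, false), (μ, false), (μ, false)]),
        ([((κ, true) : Letter d), (μ, true), (κ, false)], plaqWord κ μ, [((κ, true) : Letter d), (μ, true), (κ, false), (μ, false)]),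
        ([((κ, true) : Letter d), (κ, false)], plaqWord κ μ, [((κ, true) : Letter d), (κ, false)])] := by
  rw [stages_skylineScript_succ, stages_skylineScript_succ, stages_skylineScript_zero]
  simp [skylineWord, skylineTail, List.range_succ]

end Summit.QuantumFields.BalabanUV.T4Continuum.NE7b.LinearisedStokesSkylineScript
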